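import Literature.NumberTheory.Rogawski1990.CharIdentityOnTestFunctions
import HarnessLib

/-!
# The character identities [Rogawski1990, 13.1.4 ∕ 4.13.1 (b)] ON TEST FUNCTIONS — lemmas: OLD ⇒ NEW, read-backs, accessors

Topic `NumberTheory/Rogawski1990`; namespace `Literature.NumberTheory.Rogawski1990`.  THEOREMS ONLY (no definition, no instance, no notation, no attribute, no named fact,
no `sorry`) over the sibling statement module ★ `CharIdentityOnTestFunctions` (the `C_c^∞` twins `LocalAPacket.CharIdentityOn`, `CharIdentityAtTest`,
`CMNonsplit∕SplitCharIdentityAtTest`, `CMPacketCharIdentitiesTest`, `CMCharIdentityClausesTest`, `CMCharIdentityPackageTest`).  Cell `pub/hodgecm-mathlib`, crux H413 =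
`stmt-HodgeConjecture-24833`; REPAIR R1∕R2 of F0P3b-plan (g11)'s `FINDING-QCM-JUNK` (LEAD F0P3a-plan (g9) WORD T8-21 (A)); pen A-p19 (g21).  Every proof is one line of
logic; the point of the module is the API the closer's ED. 19b (R3) and the ★ glue twins (R4, `hCM_of_cmCharIdentityPackage` ↦ its Test twin) consume BY NAME.

* §1 generic: `CharIdentityOn.apply`, **`CharIdentity.charIdentityOn`** (OLD ⇒ NEW), `charIdentityOn_iff_charIdentity_and` (it IS ★ `CharIdentity` for the matching restricted
  to test pairs — every ★ lemma transports), `charIdentityOn_true_iff`, `CharIdentityOn.mono` (matching) ∕ `.anti` (test classes), `charIdentityOn_zero`,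
  `charIdentityOn_of_forall_not`, `charIdentityOn_map_iff`; explicit-sum read-backs `charIdentityOn_pair_iff` ∕ `_single_iff`.
* §2 CM-local: `charIdentityAtTest_pair_iff` ∕ `_single_iff` (the inline spelling of the P3b line «CMCharIdentityTest»), **`CharIdentityAt.charIdentityAtTest`**, **`CMNonsplitCharIdentityAt.test`**, **`CMSplitCharIdentityAt.test`** (OLD ⇒ NEW); the read-off lemmas
  `CMNonsplitCharIdentityAtTest.πs_isSupercuspidal` ∕ `.πs_ne` ∕ `.charIdentityAtTest_πs` + constructor `cmNonsplitCharIdentityAtTest_of_charIdentityAtTest`;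
  packet form `CMPacketCharIdentities.test`, `cmPacketCharIdentitiesTest_split` ∕ `_nonsplit`.
* §3 clauses ∕ package: accessors `CMCharIdentityClausesTest.nonsplit` ∕ `.split`, `CMCharIdentityPackageTest.clauses` ∕ `.nonsplit` ∕ `.split` (SAME argument lists as ★
  `CMCharIdentityClauses`), and OLD ⇒ NEW **`CMCharIdentityClauses.test`**, **`CMCharIdentityPackage.test`**.
HONEST SCOPE.  One-line logic; HC_CM is proved only modulo the printed citations until rung 0 closes; this file proves no printed statement.

## References
* [Rogawski1990] J. D. Rogawski, *Automorphic Representations of Unitary Groups in Three Variables*, Ann. of Math. Studies 123 (1990): §1.6 p. 6, §4.1 p. 40,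
  §4.13 Lemma 4.13.1 (b) p. 63, §12.2 p. 174, §13.1 Prop. 13.1.3 (d) and Prop. 13.1.4 p. 199, §13.3 pp. 201–202.
-/

noncomputable section

open MeasureTheory NumberField IsDedekindDomain Topology
open scoped Matrix MatrixGroups ComplexOrder

namespace Literature.NumberTheory.Rogawski1990

open Literature.NumberTheory.Automorphic Literature.NumberTheory.Automorphic.UnitaryGroup
open Literature.NumberTheory.Automorphic.UnitaryGroup.CotangentForms Literature.NumberTheory.GaloisRepresentations
open Literature.NumberTheory.Automorphic.Arthur2013.Leaves.TECR

/-! ## §1 Generic lemmas -/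

namespace LocalAPacket

variable {C : Type*}

/-- The identity at a matching TEST pair, extracted. [cite: Rogawski1990, §13.1 Prop. 13.1.4 p. 199] -/
theorem CharIdentityOn.apply {TG TH : Type*} {P : LocalAPacket C} {tr : C → TG → ℂ} {trξ : TH → ℂ} {Match : TH → TG → Prop}
    {TestH : TH → Prop} {TestG : TG → Prop} (h : P.CharIdentityOn tr trξ Match TestH TestG) {fH : TH} {f : TG} (hH : TestH fH) (hG : TestG f)
    (hm : Match fH f) : trξ fH = P.traceSum tr f :=
  h fH f hH hG hm

/-- **OLD ⇒ NEW**: the identity on ALL pairs (★ `CharIdentity`) gives the identity on any test classes. [cite: Rogawski1990, §13.1 Prop. 13.1.4 p. 199] -/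
theorem CharIdentity.charIdentityOn {TG TH : Type*} {P : LocalAPacket C} {tr : C → TG → ℂ} {trξ : TH → ℂ} {Match : TH → TG → Prop}
    (h : P.CharIdentity tr trξ Match) (TestH : TH → Prop) (TestG : TG → Prop) : P.CharIdentityOn tr trξ Match TestH TestG :=
  fun fH f _ _ hm => h fH f hm

/-- `CharIdentityOn` IS ★ `CharIdentity` for the matching restricted to test pairs (so every ★ `CharIdentity` lemma transports).
[cite: Rogawski1990, §13.1 Prop. 13.1.4 p. 199] -/
theorem charIdentityOn_iff_charIdentity_and {TG TH : Type*} (P : LocalAPacket C) (tr : C → TG → ℂ) (trξ : TH → ℂ) (Match : TH → TG → Prop)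
    (TestH : TH → Prop) (TestG : TG → Prop) :
    P.CharIdentityOn tr trξ Match TestH TestG ↔ P.CharIdentity tr trξ (fun fH f => TestH fH ∧ TestG f ∧ Match fH f) :=
  ⟨fun h fH f hm => h fH f hm.1 hm.2.1 hm.2.2, fun h fH f hH hG hm => h fH f ⟨hH, hG, hm⟩⟩

/-- With both test classes trivial, `CharIdentityOn` is ★ `CharIdentity`. [cite: Rogawski1990, §13.1 Prop. 13.1.4 p. 199] -/
theorem charIdentityOn_true_iff {TG TH : Type*} (P : LocalAPacket C) (tr : C → TG → ℂ) (trξ : TH → ℂ) (Match : TH → TG → Prop) :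
    P.CharIdentityOn tr trξ Match (fun _ => True) (fun _ => True) ↔ P.CharIdentity tr trξ Match :=
  ⟨fun h fH f hm => h fH f trivial trivial hm, fun h => h.charIdentityOn _ _⟩

/-- Monotone in the matching relation (fewer pairs, weaker demand). [cite: Rogawski1990, §13.1 Prop. 13.1.4 p. 199] -/
theorem CharIdentityOn.mono {TG TH : Type*} {P : LocalAPacket C} {tr : C → TG → ℂ} {trξ : TH → ℂ} {Match Match' : TH → TG → Prop}
    {TestH : TH → Prop} {TestG : TG → Prop} (h : P.CharIdentityOn tr trξ Match TestH TestG) (hle : ∀ fH f, Match' fH f → Match fH f) :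
    P.CharIdentityOn tr trξ Match' TestH TestG :=
  fun fH f hH hG hm => h fH f hH hG (hle fH f hm)

/-- Antitone in the test classes (smaller classes, weaker demand). [cite: Rogawski1990, §13.1 Prop. 13.1.4 p. 199] -/
theorem CharIdentityOn.anti {TG TH : Type*} {P : LocalAPacket C} {tr : C → TG → ℂ} {trξ : TH → ℂ} {Match : TH → TG → Prop}
    {TestH TestH' : TH → Prop} {TestG TestG' : TG → Prop} (h : P.CharIdentityOn tr trξ Match TestH TestG) (hH : ∀ fH, TestH' fH → TestH fH)
    (hG : ∀ f, TestG' f → TestG f) : P.CharIdentityOn tr trξ Match TestH' TestG' :=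
  fun fH f hfH hf hm => h fH f (hH fH hfH) (hG f hf) hm

/-- Non-vacuity: the identity holds for the zero characters. [cite: Rogawski1990, §13.1 Prop. 13.1.4 p. 199] -/
theorem charIdentityOn_zero {TG TH : Type*} (P : LocalAPacket C) (Match : TH → TG → Prop) (TestH : TH → Prop) (TestG : TG → Prop) :
    P.CharIdentityOn (fun _ _ => (0 : ℂ)) (fun _ => 0) Match TestH TestG :=
  (P.charIdentity_zero Match).charIdentityOn TestH TestG

/-- A matching relation with NO test pairs makes the identity vacuous. [cite: Rogawski1990, §13.1 Prop. 13.1.4 p. 199] -/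
theorem charIdentityOn_of_forall_not {TG TH : Type*} (P : LocalAPacket C) (tr : C → TG → ℂ) (trξ : TH → ℂ) {Match : TH → TG → Prop}
    {TestH : TH → Prop} {TestG : TG → Prop} (h : ∀ fH f, TestH fH → TestG f → ¬ Match fH f) : P.CharIdentityOn tr trξ Match TestH TestG :=
  fun fH f hH hG hm => absurd hm (h fH f hH hG)

/-- Transport along a map of classes: `ψ(Π)` satisfies the identity for `tr` iff `Π` does for `tr ∘ ψ`. [cite: Rogawski1990, §13.1 Prop. 13.1.4 p. 199] -/
theorem charIdentityOn_map_iff {C' TG TH : Type*} (e : C → C') (P : LocalAPacket C) (tr : C' → TG → ℂ) (trξ : TH → ℂ) (Match : TH → TG → Prop)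
    (TestH : TH → Prop) (TestG : TG → Prop) :
    (P.map e).CharIdentityOn tr trξ Match TestH TestG ↔ P.CharIdentityOn (fun c => tr (e c)) trξ Match TestH TestG := by
  simp only [CharIdentityOn, traceSum_map]

/-- **Explicit-sum form, two members**: for `Π = ⟨πⁿ, some πˢ⟩` the identity on test classes reads `trξ(f^H) = χ_{πⁿ}(f) + χ_{πˢ}(f)` (the shape the P3b
line «CMCharIdentityTest» spells inline). [cite: Rogawski1990, §13.1 Prop. 13.1.4 p. 199; §12.3 Prop. 12.3.3 (a) p. 178] -/
theorem charIdentityOn_pair_iff {TG TH : Type*} (πn πs : C) (tr : C → TG → ℂ) (trξ : TH → ℂ) (Match : TH → TG → Prop) (TestH : TH → Prop)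
    (TestG : TG → Prop) :
    (⟨πn, some πs⟩ : LocalAPacket C).CharIdentityOn tr trξ Match TestH TestG ↔
      ∀ (fH : TH) (f : TG), TestH fH → TestG f → Match fH f → trξ fH = tr πn f + tr πs f := by
  simp only [CharIdentityOn, (⟨πn, some πs⟩ : LocalAPacket C).traceSum_of_πs_eq_some tr _ rfl]

/-- **Explicit-sum form, one member** (split place): for `Π = ⟨πⁿ, none⟩` the identity on test classes reads `trξ(f^H) = χ_{πⁿ}(f)`.
[cite: Rogawski1990, §13.1 Prop. 13.1.4 p. 199; §13.3 p. 201] -/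
theorem charIdentityOn_single_iff {TG TH : Type*} (πn : C) (tr : C → TG → ℂ) (trξ : TH → ℂ) (Match : TH → TG → Prop) (TestH : TH → Prop)
    (TestG : TG → Prop) :
    (⟨πn, none⟩ : LocalAPacket C).CharIdentityOn tr trξ Match TestH TestG ↔
      ∀ (fH : TH) (f : TG), TestH fH → TestG f → Match fH f → trξ fH = tr πn f := by
  simp only [CharIdentityOn, (⟨πn, none⟩ : LocalAPacket C).traceSum_of_πs_eq_none tr _ rfl]

end LocalAPacket

/-! ## §2 CM-local lemmas: OLD ⇒ NEW, read-off, packet form -/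

section CMAt

variable (L : Type) [Field L] [NumberField L] [IsCMField L] (H' : Matrix (Fin 3) (Fin 3) L)
  (v : HeightOneSpectrum (𝓞 ↥(maximalRealSubfield L)))

/-- **OLD ⇒ NEW**: ★ `CharIdentityAt` (all pairs) gives `CharIdentityAtTest` (test pairs). [cite: Rogawski1990, §13.1 Prop. 13.1.4 p. 199] -/
theorem LocalAPacket.CharIdentityAt.charIdentityAtTest
    {_hm : MeasurableSpace ((UnitaryGroup.cmDatum L 2 (Matrix.of fun i j : Fin 2 => if i.val + j.val + 1 = 2 then (1 : L) else 0)).Local v ×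
      (UnitaryGroup.cmDatum L 1 (Matrix.of fun i j : Fin 1 => if i.val + j.val + 1 = 1 then (1 : L) else 0)).Local v)}
    {_ha : ∀ a : ((UnitaryGroup.cmDatum L 2 (Matrix.of fun i j : Fin 2 => if i.val + j.val + 1 = 2 then (1 : L) else 0)).Local v ×
        (UnitaryGroup.cmDatum L 1 (Matrix.of fun i j : Fin 1 => if i.val + j.val + 1 = 1 then (1 : L) else 0)).Local v),
      MeasurableSpace (((UnitaryGroup.cmDatum L 2 (Matrix.of fun i j : Fin 2 => if i.val + j.val + 1 = 2 then (1 : L) else 0)).Local v ×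
        (UnitaryGroup.cmDatum L 1 (Matrix.of fun i j : Fin 1 => if i.val + j.val + 1 = 1 then (1 : L) else 0)).Local v) ⧸
        Subgroup.centralizer ({a} : Set ((UnitaryGroup.cmDatum L 2 (Matrix.of fun i j : Fin 2 => if i.val + j.val + 1 = 2 then (1 : L) else 0)).Local v ×
        (UnitaryGroup.cmDatum L 1 (Matrix.of fun i j : Fin 1 => if i.val + j.val + 1 = 1 then (1 : L) else 0)).Local v)))}
    {_hγ : ∀ γ : (UnitaryGroup.cmDatum L 3 H').Local v,
      MeasurableSpace ((UnitaryGroup.cmDatum L 3 H').Local v ⧸ Subgroup.centralizer ({γ} : Set ((UnitaryGroup.cmDatum L 3 H').Local v)))}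
    {P : CMLocalAPacket L H' v}
    {tr : IrrClass ((UnitaryGroup.cmDatum L 3 H').Local v) → ((UnitaryGroup.cmDatum L 3 H').Local v → ℂ) → ℂ}
    {ξ : (UnitaryGroup.cmDatum L 2 (Matrix.of fun i j : Fin 2 => if i.val + j.val + 1 = 2 then (1 : L) else 0)).Local v ×
        (UnitaryGroup.cmDatum L 1 (Matrix.of fun i j : Fin 1 => if i.val + j.val + 1 = 1 then (1 : L) else 0)).Local v →* ℂˣ}
    {μH : Measure ((UnitaryGroup.cmDatum L 2 (Matrix.of fun i j : Fin 2 => if i.val + j.val + 1 = 2 then (1 : L) else 0)).Local v ×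
        (UnitaryGroup.cmDatum L 1 (Matrix.of fun i j : Fin 1 => if i.val + j.val + 1 = 1 then (1 : L) else 0)).Local v)}
    {T : LocalTransferFactor L H' v}
    {mH : OrbitalMeasureFamily ((UnitaryGroup.cmDatum L 2 (Matrix.of fun i j : Fin 2 => if i.val + j.val + 1 = 2 then (1 : L) else 0)).Local v ×
        (UnitaryGroup.cmDatum L 1 (Matrix.of fun i j : Fin 1 => if i.val + j.val + 1 = 1 then (1 : L) else 0)).Local v)}
    {mG : OrbitalMeasureFamily ((UnitaryGroup.cmDatum L 3 H').Local v)} (h : P.CharIdentityAt L H' v tr ξ μH T mH mG) :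
    P.CharIdentityAtTest L H' v tr ξ μH T mH mG :=
  LocalAPacket.CharIdentity.charIdentityOn h _ _


/-- **Explicit-sum form at `v`, two members** (the inline spelling of the P3b line «CMCharIdentityTest»): `∫ ξ f^H dμ_H = Tr πⁿ(f) + Tr πˢ(f)` for every `Δ`-matching
pair of test functions. [cite: Rogawski1990, §13.1 Prop. 13.1.4 p. 199; §12.3 Prop. 12.3.3 (a) p. 178] -/
theorem LocalAPacket.charIdentityAtTest_pair_iff
    {_hm : MeasurableSpace ((UnitaryGroup.cmDatum L 2 (Matrix.of fun i j : Fin 2 => if i.val + j.val + 1 = 2 then (1 : L) else 0)).Local v ×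
      (UnitaryGroup.cmDatum L 1 (Matrix.of fun i j : Fin 1 => if i.val + j.val + 1 = 1 then (1 : L) else 0)).Local v)}
    {_ha : ∀ a : ((UnitaryGroup.cmDatum L 2 (Matrix.of fun i j : Fin 2 => if i.val + j.val + 1 = 2 then (1 : L) else 0)).Local v ×
        (UnitaryGroup.cmDatum L 1 (Matrix.of fun i j : Fin 1 => if i.val + j.val + 1 = 1 then (1 : L) else 0)).Local v),
      MeasurableSpace (((UnitaryGroup.cmDatum L 2 (Matrix.of fun i j : Fin 2 => if i.val + j.val + 1 = 2 then (1 : L) else 0)).Local v ×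
        (UnitaryGroup.cmDatum L 1 (Matrix.of fun i j : Fin 1 => if i.val + j.val + 1 = 1 then (1 : L) else 0)).Local v) ⧸
        Subgroup.centralizer ({a} : Set ((UnitaryGroup.cmDatum L 2 (Matrix.of fun i j : Fin 2 => if i.val + j.val + 1 = 2 then (1 : L) else 0)).Local v ×
        (UnitaryGroup.cmDatum L 1 (Matrix.of fun i j : Fin 1 => if i.val + j.val + 1 = 1 then (1 : L) else 0)).Local v)))}
    {_hγ : ∀ γ : (UnitaryGroup.cmDatum L 3 H').Local v,
      MeasurableSpace ((UnitaryGroup.cmDatum L 3 H').Local v ⧸ Subgroup.centralizer ({γ} : Set ((UnitaryGroup.cmDatum L 3 H').Local v)))}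
    (πn πs : IrrClass ((UnitaryGroup.cmDatum L 3 H').Local v))
    (tr : IrrClass ((UnitaryGroup.cmDatum L 3 H').Local v) → ((UnitaryGroup.cmDatum L 3 H').Local v → ℂ) → ℂ)
    (ξ : (UnitaryGroup.cmDatum L 2 (Matrix.of fun i j : Fin 2 => if i.val + j.val + 1 = 2 then (1 : L) else 0)).Local v ×
        (UnitaryGroup.cmDatum L 1 (Matrix.of fun i j : Fin 1 => if i.val + j.val + 1 = 1 then (1 : L) else 0)).Local v →* ℂˣ)
    (μH : Measure ((UnitaryGroup.cmDatum L 2 (Matrix.of fun i j : Fin 2 => if i.val + j.val + 1 = 2 then (1 : L) else 0)).Local v ×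
        (UnitaryGroup.cmDatum L 1 (Matrix.of fun i j : Fin 1 => if i.val + j.val + 1 = 1 then (1 : L) else 0)).Local v))
    (T : LocalTransferFactor L H' v)
    (mH : OrbitalMeasureFamily ((UnitaryGroup.cmDatum L 2 (Matrix.of fun i j : Fin 2 => if i.val + j.val + 1 = 2 then (1 : L) else 0)).Local v ×
        (UnitaryGroup.cmDatum L 1 (Matrix.of fun i j : Fin 1 => if i.val + j.val + 1 = 1 then (1 : L) else 0)).Local v))
    (mG : OrbitalMeasureFamily ((UnitaryGroup.cmDatum L 3 H').Local v)) :
    (⟨πn, some πs⟩ : CMLocalAPacket L H' v).CharIdentityAtTest L H' v tr ξ μH T mH mG ↔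
      ∀ fH f, IsLocSmooth fH → IsLocSmooth f → IsLocalDeltaTransfer L H' v T mH mG fH f → charDist ξ μH fH = tr πn f + tr πs f :=
  LocalAPacket.charIdentityOn_pair_iff πn πs tr (charDist ξ μH) _ IsLocSmooth IsLocSmooth

/-- **Explicit-sum form at `v`, one member** (split place, `Π = ⟨πⁿ, none⟩`, e.g. ★ `cmSplitPacket`): `∫ ξ f^H dμ_H = Tr πⁿ(f)` for every `Δ`-matching pair of test
functions. [cite: Rogawski1990, §13.1 Prop. 13.1.4 p. 199; §4.13 Lemma 4.13.1 (b) p. 63; §13.3 p. 201] -/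
theorem LocalAPacket.charIdentityAtTest_single_iff
    {_hm : MeasurableSpace ((UnitaryGroup.cmDatum L 2 (Matrix.of fun i j : Fin 2 => if i.val + j.val + 1 = 2 then (1 : L) else 0)).Local v ×
      (UnitaryGroup.cmDatum L 1 (Matrix.of fun i j : Fin 1 => if i.val + j.val + 1 = 1 then (1 : L) else 0)).Local v)}
    {_ha : ∀ a : ((UnitaryGroup.cmDatum L 2 (Matrix.of fun i j : Fin 2 => if i.val + j.val + 1 = 2 then (1 : L) else 0)).Local v ×
        (UnitaryGroup.cmDatum L 1 (Matrix.of fun i j : Fin 1 => if i.val + j.val + 1 = 1 then (1 : L) else 0)).Local v),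
      MeasurableSpace (((UnitaryGroup.cmDatum L 2 (Matrix.of fun i j : Fin 2 => if i.val + j.val + 1 = 2 then (1 : L) else 0)).Local v ×
        (UnitaryGroup.cmDatum L 1 (Matrix.of fun i j : Fin 1 => if i.val + j.val + 1 = 1 then (1 : L) else 0)).Local v) ⧸
        Subgroup.centralizer ({a} : Set ((UnitaryGroup.cmDatum L 2 (Matrix.of fun i j : Fin 2 => if i.val + j.val + 1 = 2 then (1 : L) else 0)).Local v ×
        (UnitaryGroup.cmDatum L 1 (Matrix.of fun i j : Fin 1 => if i.val + j.val + 1 = 1 then (1 : L) else 0)).Local v)))}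
    {_hγ : ∀ γ : (UnitaryGroup.cmDatum L 3 H').Local v,
      MeasurableSpace ((UnitaryGroup.cmDatum L 3 H').Local v ⧸ Subgroup.centralizer ({γ} : Set ((UnitaryGroup.cmDatum L 3 H').Local v)))}
    (πn : IrrClass ((UnitaryGroup.cmDatum L 3 H').Local v))
    (tr : IrrClass ((UnitaryGroup.cmDatum L 3 H').Local v) → ((UnitaryGroup.cmDatum L 3 H').Local v → ℂ) → ℂ)
    (ξ : (UnitaryGroup.cmDatum L 2 (Matrix.of fun i j : Fin 2 => if i.val + j.val + 1 = 2 then (1 : L) else 0)).Local v ×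
        (UnitaryGroup.cmDatum L 1 (Matrix.of fun i j : Fin 1 => if i.val + j.val + 1 = 1 then (1 : L) else 0)).Local v →* ℂˣ)
    (μH : Measure ((UnitaryGroup.cmDatum L 2 (Matrix.of fun i j : Fin 2 => if i.val + j.val + 1 = 2 then (1 : L) else 0)).Local v ×
        (UnitaryGroup.cmDatum L 1 (Matrix.of fun i j : Fin 1 => if i.val + j.val + 1 = 1 then (1 : L) else 0)).Local v))
    (T : LocalTransferFactor L H' v)
    (mH : OrbitalMeasureFamily ((UnitaryGroup.cmDatum L 2 (Matrix.of fun i j : Fin 2 => if i.val + j.val + 1 = 2 then (1 : L) else 0)).Local v ×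
        (UnitaryGroup.cmDatum L 1 (Matrix.of fun i j : Fin 1 => if i.val + j.val + 1 = 1 then (1 : L) else 0)).Local v))
    (mG : OrbitalMeasureFamily ((UnitaryGroup.cmDatum L 3 H').Local v)) :
    (⟨πn, none⟩ : CMLocalAPacket L H' v).CharIdentityAtTest L H' v tr ξ μH T mH mG ↔
      ∀ fH f, IsLocSmooth fH → IsLocSmooth f → IsLocalDeltaTransfer L H' v T mH mG fH f → charDist ξ μH fH = tr πn f :=
  LocalAPacket.charIdentityOn_single_iff πn tr (charDist ξ μH) _ IsLocSmooth IsLocSmooth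

end CMAt

section CM

variable (L : Type) [Field L] [NumberField L] [IsCMField L]
  (v : HeightOneSpectrum (𝓞 ↥(maximalRealSubfield L)))

variable (H' : Matrix (Fin 3) (Fin 3) L)

variable
    [MeasurableSpace ((UnitaryGroup.cmDatum L 3 H').Local v)]
    [MeasurableSpace ((UnitaryGroup.cmDatum L 2 (Matrix.of fun i j : Fin 2 => if i.val + j.val + 1 = 2 then (1 : L) else 0)).Local v ×
      (UnitaryGroup.cmDatum L 1 (Matrix.of fun i j : Fin 1 => if i.val + j.val + 1 = 1 then (1 : L) else 0)).Local v)]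
    [∀ a : ((UnitaryGroup.cmDatum L 2 (Matrix.of fun i j : Fin 2 => if i.val + j.val + 1 = 2 then (1 : L) else 0)).Local v ×
        (UnitaryGroup.cmDatum L 1 (Matrix.of fun i j : Fin 1 => if i.val + j.val + 1 = 1 then (1 : L) else 0)).Local v),
      MeasurableSpace (((UnitaryGroup.cmDatum L 2 (Matrix.of fun i j : Fin 2 => if i.val + j.val + 1 = 2 then (1 : L) else 0)).Local v ×
        (UnitaryGroup.cmDatum L 1 (Matrix.of fun i j : Fin 1 => if i.val + j.val + 1 = 1 then (1 : L) else 0)).Local v) ⧸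
        Subgroup.centralizer ({a} : Set ((UnitaryGroup.cmDatum L 2 (Matrix.of fun i j : Fin 2 => if i.val + j.val + 1 = 2 then (1 : L) else 0)).Local v ×
        (UnitaryGroup.cmDatum L 1 (Matrix.of fun i j : Fin 1 => if i.val + j.val + 1 = 1 then (1 : L) else 0)).Local v)))]
    [∀ γ : (UnitaryGroup.cmDatum L 3 H').Local v,
      MeasurableSpace ((UnitaryGroup.cmDatum L 3 H').Local v ⧸ Subgroup.centralizer ({γ} : Set ((UnitaryGroup.cmDatum L 3 H').Local v)))]

/-- **OLD ⇒ NEW**: ★ `CMNonsplitCharIdentityAt` gives `CMNonsplitCharIdentityAtTest` (same witness `πˢ`). [cite: Rogawski1990, §13.1 Prop. 13.1.4 p. 199] -/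
theorem CMNonsplitCharIdentityAt.test
    {T : LocalTransferFactor L H' v}
    {mH : OrbitalMeasureFamily ((UnitaryGroup.cmDatum L 2 (Matrix.of fun i j : Fin 2 => if i.val + j.val + 1 = 2 then (1 : L) else 0)).Local v ×
        (UnitaryGroup.cmDatum L 1 (Matrix.of fun i j : Fin 1 => if i.val + j.val + 1 = 1 then (1 : L) else 0)).Local v)}
    {mG : OrbitalMeasureFamily ((UnitaryGroup.cmDatum L 3 H').Local v)} {μG : Measure ((UnitaryGroup.cmDatum L 3 H').Local v)}
    {μH : Measure ((UnitaryGroup.cmDatum L 2 (Matrix.of fun i j : Fin 2 => if i.val + j.val + 1 = 2 then (1 : L) else 0)).Local v ×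
        (UnitaryGroup.cmDatum L 1 (Matrix.of fun i j : Fin 1 => if i.val + j.val + 1 = 1 then (1 : L) else 0)).Local v)}
    {ξv : (UnitaryGroup.cmDatum L 2 (Matrix.of fun i j : Fin 2 => if i.val + j.val + 1 = 2 then (1 : L) else 0)).Local v ×
        (UnitaryGroup.cmDatum L 1 (Matrix.of fun i j : Fin 1 => if i.val + j.val + 1 = 1 then (1 : L) else 0)).Local v →* ℂˣ}
    {πn : IrrClass ((UnitaryGroup.cmDatum L 3 H').Local v)} (h : CMNonsplitCharIdentityAt L v H' T mH mG μG μH ξv πn) :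
    CMNonsplitCharIdentityAtTest L v H' T mH mG μG μH ξv πn := by
  obtain ⟨πs, hsc, hne, hP⟩ := h
  exact ⟨πs, hsc, hne, hP.charIdentityAtTest⟩

variable (hH' : (H'.map (cmConjRingHom L))ᵀ = H') (hH'd : IsUnit H'.det)

/-- **OLD ⇒ NEW**: ★ `CMSplitCharIdentityAt` gives `CMSplitCharIdentityAtTest`. [cite: Rogawski1990, §13.1 Prop. 13.1.4 p. 199; §4.13 Lemma 4.13.1 (b) p. 63] -/
theorem CMSplitCharIdentityAt.test
    {w : UnitaryGroup.PlacesOver L v} {hw : IsCMField.complexConj L • w.1 ≠ w.1}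
    [LocallyCompactSpace (standardParabolicGL (w.1.adicCompletion L) (Zelevinsky1980.lastBlockLabel 3))]
    {ν₀ χ' : (w.1.adicCompletion L)ˣ →* ℂˣ} {hν₀u : ∀ x, ‖((ν₀ x : ℂˣ) : ℂ)‖ = 1}
    {hν₀c : Continuous fun x => ((ν₀ x : ℂˣ) : ℂ)} {hχ'u : ∀ x, ‖((χ' x : ℂˣ) : ℂ)‖ = 1}
    {hχ'c : Continuous fun x => ((χ' x : ℂˣ) : ℂ)}
    {T : LocalTransferFactor L H' v}
    {mH : OrbitalMeasureFamily ((UnitaryGroup.cmDatum L 2 (Matrix.of fun i j : Fin 2 => if i.val + j.val + 1 = 2 then (1 : L) else 0)).Local v ×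
        (UnitaryGroup.cmDatum L 1 (Matrix.of fun i j : Fin 1 => if i.val + j.val + 1 = 1 then (1 : L) else 0)).Local v)}
    {mG : OrbitalMeasureFamily ((UnitaryGroup.cmDatum L 3 H').Local v)} {μG : Measure ((UnitaryGroup.cmDatum L 3 H').Local v)}
    {μH : Measure ((UnitaryGroup.cmDatum L 2 (Matrix.of fun i j : Fin 2 => if i.val + j.val + 1 = 2 then (1 : L) else 0)).Local v ×
        (UnitaryGroup.cmDatum L 1 (Matrix.of fun i j : Fin 1 => if i.val + j.val + 1 = 1 then (1 : L) else 0)).Local v)}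
    {ξv : (UnitaryGroup.cmDatum L 2 (Matrix.of fun i j : Fin 2 => if i.val + j.val + 1 = 2 then (1 : L) else 0)).Local v ×
        (UnitaryGroup.cmDatum L 1 (Matrix.of fun i j : Fin 1 => if i.val + j.val + 1 = 1 then (1 : L) else 0)).Local v →* ℂˣ}
    (h : CMSplitCharIdentityAt L v H' hH' hH'd w hw ν₀ χ' hν₀u hν₀c hχ'u hχ'c T mH mG μG μH ξv) :
    CMSplitCharIdentityAtTest L v H' hH' hH'd w hw ν₀ χ' hν₀u hν₀c hχ'u hχ'c T mH mG μG μH ξv :=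
  LocalAPacket.CharIdentityAt.charIdentityAtTest L H' v h

end CM

section ReadOff

variable {L : Type} [Field L] [NumberField L] [IsCMField L] {v : HeightOneSpectrum (𝓞 ↥(maximalRealSubfield L))}
  {H' : Matrix (Fin 3) (Fin 3) L}

variable
    [MeasurableSpace ((UnitaryGroup.cmDatum L 3 H').Local v)]
    [MeasurableSpace ((UnitaryGroup.cmDatum L 2 (Matrix.of fun i j : Fin 2 => if i.val + j.val + 1 = 2 then (1 : L) else 0)).Local v ×
      (UnitaryGroup.cmDatum L 1 (Matrix.of fun i j : Fin 1 => if i.val + j.val + 1 = 1 then (1 : L) else 0)).Local v)]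
    [∀ a : ((UnitaryGroup.cmDatum L 2 (Matrix.of fun i j : Fin 2 => if i.val + j.val + 1 = 2 then (1 : L) else 0)).Local v ×
        (UnitaryGroup.cmDatum L 1 (Matrix.of fun i j : Fin 1 => if i.val + j.val + 1 = 1 then (1 : L) else 0)).Local v),
      MeasurableSpace (((UnitaryGroup.cmDatum L 2 (Matrix.of fun i j : Fin 2 => if i.val + j.val + 1 = 2 then (1 : L) else 0)).Local v ×
        (UnitaryGroup.cmDatum L 1 (Matrix.of fun i j : Fin 1 => if i.val + j.val + 1 = 1 then (1 : L) else 0)).Local v) ⧸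
        Subgroup.centralizer ({a} : Set ((UnitaryGroup.cmDatum L 2 (Matrix.of fun i j : Fin 2 => if i.val + j.val + 1 = 2 then (1 : L) else 0)).Local v ×
        (UnitaryGroup.cmDatum L 1 (Matrix.of fun i j : Fin 1 => if i.val + j.val + 1 = 1 then (1 : L) else 0)).Local v)))]
    [∀ γ : (UnitaryGroup.cmDatum L 3 H').Local v,
      MeasurableSpace ((UnitaryGroup.cmDatum L 3 H').Local v ⧸ Subgroup.centralizer ({γ} : Set ((UnitaryGroup.cmDatum L 3 H').Local v)))]
    {T : LocalTransferFactor L H' v}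
    {mH : OrbitalMeasureFamily ((UnitaryGroup.cmDatum L 2 (Matrix.of fun i j : Fin 2 => if i.val + j.val + 1 = 2 then (1 : L) else 0)).Local v ×
        (UnitaryGroup.cmDatum L 1 (Matrix.of fun i j : Fin 1 => if i.val + j.val + 1 = 1 then (1 : L) else 0)).Local v)}
    {mG : OrbitalMeasureFamily ((UnitaryGroup.cmDatum L 3 H').Local v)} {μG : Measure ((UnitaryGroup.cmDatum L 3 H').Local v)}
    {μH : Measure ((UnitaryGroup.cmDatum L 2 (Matrix.of fun i j : Fin 2 => if i.val + j.val + 1 = 2 then (1 : L) else 0)).Local v ×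
        (UnitaryGroup.cmDatum L 1 (Matrix.of fun i j : Fin 1 => if i.val + j.val + 1 = 1 then (1 : L) else 0)).Local v)}
    {ξv : (UnitaryGroup.cmDatum L 2 (Matrix.of fun i j : Fin 2 => if i.val + j.val + 1 = 2 then (1 : L) else 0)).Local v ×
        (UnitaryGroup.cmDatum L 1 (Matrix.of fun i j : Fin 1 => if i.val + j.val + 1 = 1 then (1 : L) else 0)).Local v →* ℂˣ}
    {πn : IrrClass ((UnitaryGroup.cmDatum L 3 H').Local v)}

/-- `h.πs` is supercuspidal [13.1.3 (d)]. [cite: Rogawski1990, §13.1 Prop. 13.1.3 (d) p. 199] -/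
theorem CMNonsplitCharIdentityAtTest.πs_isSupercuspidal (h : CMNonsplitCharIdentityAtTest L v H' T mH mG μG μH ξv πn) : h.πs.IsSupercuspidal :=
  (Exists.choose_spec h).1

/-- `h.πs ≠ πⁿ`. [cite: Rogawski1990, §13.1 Prop. 13.1.3 (d) p. 199] -/
theorem CMNonsplitCharIdentityAtTest.πs_ne (h : CMNonsplitCharIdentityAtTest L v H' T mH mG μG μH ξv πn) : h.πs ≠ πn :=
  (Exists.choose_spec h).2.1

/-- **The packet `{πⁿ, h.πs}` satisfies [13.1.4] on test functions** on the given data. [cite: Rogawski1990, §13.1 Prop. 13.1.4 p. 199] -/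
theorem CMNonsplitCharIdentityAtTest.charIdentityAtTest_πs (h : CMNonsplitCharIdentityAtTest L v H' T mH mG μG μH ξv πn) :
    (⟨πn, some h.πs⟩ : CMLocalAPacket L H' v).CharIdentityAtTest L H' v (fun c f => c.smoothTrace μG f) ξv μH T mH mG :=
  (Exists.choose_spec h).2.2

/-- Constructor: a packet `⟨πⁿ, some πˢ⟩` with `πˢ` supercuspidal `≠ πⁿ` satisfying [13.1.4] on test functions gives `CMNonsplitCharIdentityAtTest … πⁿ`.
[cite: Rogawski1990, §13.1 Prop. 13.1.3 (d), Prop. 13.1.4 p. 199] -/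
theorem cmNonsplitCharIdentityAtTest_of_charIdentityAtTest (πs : IrrClass ((UnitaryGroup.cmDatum L 3 H').Local v)) (hsc : πs.IsSupercuspidal) (hne : πs ≠ πn)
    (h : (⟨πn, some πs⟩ : CMLocalAPacket L H' v).CharIdentityAtTest L H' v (fun c f => c.smoothTrace μG f) ξv μH T mH mG) :
    CMNonsplitCharIdentityAtTest L v H' T mH mG μG μH ξv πn :=
  ⟨πs, hsc, hne, h⟩

end ReadOff

section PacketForm

variable (L : Type) [Field L] [NumberField L] [IsCMField L] (H' : Matrix (Fin 3) (Fin 3) L)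

variable
    [∀ v : HeightOneSpectrum (𝓞 ↥(maximalRealSubfield L)), MeasurableSpace ((UnitaryGroup.cmDatum L 3 H').Local v)]
    [∀ v : HeightOneSpectrum (𝓞 ↥(maximalRealSubfield L)),
      MeasurableSpace ((UnitaryGroup.cmDatum L 2 (Matrix.of fun i j : Fin 2 => if i.val + j.val + 1 = 2 then (1 : L) else 0)).Local v ×
        (UnitaryGroup.cmDatum L 1 (Matrix.of fun i j : Fin 1 => if i.val + j.val + 1 = 1 then (1 : L) else 0)).Local v)]
    [∀ (v : HeightOneSpectrum (𝓞 ↥(maximalRealSubfield L)))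
        (a : ((UnitaryGroup.cmDatum L 2 (Matrix.of fun i j : Fin 2 => if i.val + j.val + 1 = 2 then (1 : L) else 0)).Local v ×
          (UnitaryGroup.cmDatum L 1 (Matrix.of fun i j : Fin 1 => if i.val + j.val + 1 = 1 then (1 : L) else 0)).Local v)),
      MeasurableSpace (((UnitaryGroup.cmDatum L 2 (Matrix.of fun i j : Fin 2 => if i.val + j.val + 1 = 2 then (1 : L) else 0)).Local v ×
          (UnitaryGroup.cmDatum L 1 (Matrix.of fun i j : Fin 1 => if i.val + j.val + 1 = 1 then (1 : L) else 0)).Local v) ⧸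
        Subgroup.centralizer ({a} : Set ((UnitaryGroup.cmDatum L 2 (Matrix.of fun i j : Fin 2 => if i.val + j.val + 1 = 2 then (1 : L) else 0)).Local v ×
          (UnitaryGroup.cmDatum L 1 (Matrix.of fun i j : Fin 1 => if i.val + j.val + 1 = 1 then (1 : L) else 0)).Local v)))]
    [∀ (v : HeightOneSpectrum (𝓞 ↥(maximalRealSubfield L))) (γ : (UnitaryGroup.cmDatum L 3 H').Local v),
      MeasurableSpace ((UnitaryGroup.cmDatum L 3 H').Local v ⧸ Subgroup.centralizer ({γ} : Set ((UnitaryGroup.cmDatum L 3 H').Local v)))]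

variable {L H'}
variable
  {Δ : ∀ v : HeightOneSpectrum (𝓞 ↥(maximalRealSubfield L)), LocalTransferFactor L H' v}
  {mH : ∀ v : HeightOneSpectrum (𝓞 ↥(maximalRealSubfield L)),
      OrbitalMeasureFamily ((UnitaryGroup.cmDatum L 2 (Matrix.of fun i j : Fin 2 => if i.val + j.val + 1 = 2 then (1 : L) else 0)).Local v ×
        (UnitaryGroup.cmDatum L 1 (Matrix.of fun i j : Fin 1 => if i.val + j.val + 1 = 1 then (1 : L) else 0)).Local v)}
  {mG : ∀ v : HeightOneSpectrum (𝓞 ↥(maximalRealSubfield L)), OrbitalMeasureFamily ((UnitaryGroup.cmDatum L 3 H').Local v)}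
  {μG : ∀ v : HeightOneSpectrum (𝓞 ↥(maximalRealSubfield L)), Measure ((UnitaryGroup.cmDatum L 3 H').Local v)}
  {μH : ∀ v : HeightOneSpectrum (𝓞 ↥(maximalRealSubfield L)),
      Measure ((UnitaryGroup.cmDatum L 2 (Matrix.of fun i j : Fin 2 => if i.val + j.val + 1 = 2 then (1 : L) else 0)).Local v ×
        (UnitaryGroup.cmDatum L 1 (Matrix.of fun i j : Fin 1 => if i.val + j.val + 1 = 1 then (1 : L) else 0)).Local v)}
  {ξloc : ∀ v : HeightOneSpectrum (𝓞 ↥(maximalRealSubfield L)),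
      (UnitaryGroup.cmDatum L 2 (Matrix.of fun i j : Fin 2 => if i.val + j.val + 1 = 2 then (1 : L) else 0)).Local v ×
        (UnitaryGroup.cmDatum L 1 (Matrix.of fun i j : Fin 1 => if i.val + j.val + 1 = 1 then (1 : L) else 0)).Local v →* ℂˣ}
  {P : ∀ v : HeightOneSpectrum (𝓞 ↥(maximalRealSubfield L)), CMLocalAPacket L H' v}

/-- **OLD ⇒ NEW**: ★ `CMPacketCharIdentities` gives `CMPacketCharIdentitiesTest`. [cite: Rogawski1990, §13.1 Prop. 13.1.4 p. 199] -/
theorem CMPacketCharIdentities.test (h : CMPacketCharIdentities L H' Δ mH mG μG μH ξloc P) : CMPacketCharIdentitiesTest L H' Δ mH mG μG μH ξloc P :=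
  fun v => (h v).charIdentityAtTest

/-- **Read-back at a SPLIT place**: where the family is the split packet of record, the packet-form conjunct IS `CMSplitCharIdentityAtTest` at those labels.
[cite: Rogawski1990, §13.1 Prop. 13.1.4 p. 199; §4.13 Lemma 4.13.1 (b) p. 63; §13.3 p. 201] -/
theorem cmPacketCharIdentitiesTest_split {hH' : (H'.map (cmConjRingHom L))ᵀ = H'} {hH'd : IsUnit H'.det}
    (h : CMPacketCharIdentitiesTest L H' Δ mH mG μG μH ξloc P) (v : HeightOneSpectrum (𝓞 ↥(maximalRealSubfield L)))
    (w : UnitaryGroup.PlacesOver L v) (hw : IsCMField.complexConj L • w.1 ≠ w.1)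
    [LocallyCompactSpace (standardParabolicGL (w.1.adicCompletion L) (Zelevinsky1980.lastBlockLabel 3))]
    (ν₀ χ' : (w.1.adicCompletion L)ˣ →* ℂˣ) (hν₀u : ∀ x, ‖((ν₀ x : ℂˣ) : ℂ)‖ = 1)
    (hν₀c : Continuous fun x => ((ν₀ x : ℂˣ) : ℂ)) (hχ'u : ∀ x, ‖((χ' x : ℂˣ) : ℂ)‖ = 1)
    (hχ'c : Continuous fun x => ((χ' x : ℂˣ) : ℂ))
    (hP : P v = cmSplitPacket L H' hH' hH'd v w hw ν₀ χ' hν₀u hν₀c hχ'u hχ'c) :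
    CMSplitCharIdentityAtTest L v H' hH' hH'd w hw ν₀ χ' hν₀u hν₀c hχ'u hχ'c (Δ v) (mH v) (mG v) (μG v) (μH v) (ξloc v) := by
  have hv := h v
  rw [hP] at hv
  exact hv

/-- **Read-back at a NON-SPLIT place**: where the family's second member is `some πˢ` with `πˢ` SUPERCUSPIDAL and `πˢ ≠ πⁿ` [13.1.3 (d)], the packet-form conjunct
GIVES `CMNonsplitCharIdentityAtTest … πⁿ` (witness `πˢ`). [cite: Rogawski1990, §13.1 Prop. 13.1.3 (d), Prop. 13.1.4 p. 199] -/
theorem cmPacketCharIdentitiesTest_nonsplit (h : CMPacketCharIdentitiesTest L H' Δ mH mG μG μH ξloc P) (v : HeightOneSpectrum (𝓞 ↥(maximalRealSubfield L)))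
    (πs : IrrClass ((UnitaryGroup.cmDatum L 3 H').Local v)) (hπs : (P v).πs = some πs) (hsc : πs.IsSupercuspidal) (hne : πs ≠ (P v).πn) :
    CMNonsplitCharIdentityAtTest L v H' (Δ v) (mH v) (mG v) (μG v) (μH v) (ξloc v) (P v).πn := by
  refine ⟨πs, hsc, hne, ?_⟩
  have hPv : (⟨(P v).πn, some πs⟩ : CMLocalAPacket L H' v) = P v := LocalAPacket.ext' rfl hπs.symm
  rw [hPv]
  exact h v

end PacketForm

/-! ## §3 Clauses and package: accessors and OLD ⇒ NEW -/

section Clauses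

variable (L : Type) [Field L] [NumberField L] [IsCMField L] (H : Matrix (Fin 3) (Fin 3) L)
  (hH : (H.map (cmConjRingHom L))ᵀ = H) (hHd : IsUnit H.det)

variable
    [∀ v : HeightOneSpectrum (𝓞 ↥(maximalRealSubfield L)), MeasurableSpace ((cmDatum L 3 H).Local v)]
    [∀ v : HeightOneSpectrum (𝓞 ↥(maximalRealSubfield L)),
      MeasurableSpace ((cmDatum L 2 (Matrix.of fun i j : Fin 2 => if i.val + j.val + 1 = 2 then (1 : L) else 0)).Local v ×
        (cmDatum L 1 (Matrix.of fun i j : Fin 1 => if i.val + j.val + 1 = 1 then (1 : L) else 0)).Local v)]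
    [∀ (v : HeightOneSpectrum (𝓞 ↥(maximalRealSubfield L)))
        (a : ((cmDatum L 2 (Matrix.of fun i j : Fin 2 => if i.val + j.val + 1 = 2 then (1 : L) else 0)).Local v ×
          (cmDatum L 1 (Matrix.of fun i j : Fin 1 => if i.val + j.val + 1 = 1 then (1 : L) else 0)).Local v)),
      MeasurableSpace (((cmDatum L 2 (Matrix.of fun i j : Fin 2 => if i.val + j.val + 1 = 2 then (1 : L) else 0)).Local v ×
          (cmDatum L 1 (Matrix.of fun i j : Fin 1 => if i.val + j.val + 1 = 1 then (1 : L) else 0)).Local v) ⧸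
        Subgroup.centralizer ({a} : Set ((cmDatum L 2 (Matrix.of fun i j : Fin 2 => if i.val + j.val + 1 = 2 then (1 : L) else 0)).Local v ×
          (cmDatum L 1 (Matrix.of fun i j : Fin 1 => if i.val + j.val + 1 = 1 then (1 : L) else 0)).Local v)))]
    [∀ (v : HeightOneSpectrum (𝓞 ↥(maximalRealSubfield L))) (γ : (cmDatum L 3 H).Local v),
      MeasurableSpace ((cmDatum L 3 H).Local v ⧸ Subgroup.centralizer ({γ} : Set ((cmDatum L 3 H).Local v)))]

variable {L H hH hHd}
variable
  {Δ : ∀ v : HeightOneSpectrum (𝓞 ↥(maximalRealSubfield L)), LocalTransferFactor L H v}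
  {mH : ∀ v : HeightOneSpectrum (𝓞 ↥(maximalRealSubfield L)),
    OrbitalMeasureFamily ((cmDatum L 2 (Matrix.of fun i j : Fin 2 => if i.val + j.val + 1 = 2 then (1 : L) else 0)).Local v ×
      (cmDatum L 1 (Matrix.of fun i j : Fin 1 => if i.val + j.val + 1 = 1 then (1 : L) else 0)).Local v)}
  {mG : ∀ v : HeightOneSpectrum (𝓞 ↥(maximalRealSubfield L)), OrbitalMeasureFamily ((cmDatum L 3 H).Local v)}
  {νH : ∀ v : HeightOneSpectrum (𝓞 ↥(maximalRealSubfield L)),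
    Measure ((cmDatum L 2 (Matrix.of fun i j : Fin 2 => if i.val + j.val + 1 = 2 then (1 : L) else 0)).Local v ×
      (cmDatum L 1 (Matrix.of fun i j : Fin 1 => if i.val + j.val + 1 = 1 then (1 : L) else 0)).Local v)}
  {νG : ∀ v : HeightOneSpectrum (𝓞 ↥(maximalRealSubfield L)), Measure ((cmDatum L 3 H).Local v)}
  {ξ : OneDimAutRepH L} {μω : HeckeCharacter L} {hμu : μω.IsUnitary}
  {ξloc : ∀ v : HeightOneSpectrum (𝓞 ↥(maximalRealSubfield L)),
    (cmDatum L 2 (Matrix.of fun i j : Fin 2 => if i.val + j.val + 1 = 2 then (1 : L) else 0)).Local v ×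
      (cmDatum L 1 (Matrix.of fun i j : Fin 1 => if i.val + j.val + 1 = 1 then (1 : L) else 0)).Local v →* ℂˣ}

/-- **Read-back at a NON-SPLIT place** (the shape the consumer's slot `some (…).πs` destructures): the identity [13.1.4] on test functions for `{πⁿ ∘ e⁻¹, πˢ}`.
[cite: Rogawski1990, §13.1 Prop. 13.1.3 (d), Prop. 13.1.4 p. 199; §12.2 p. 174] -/
theorem CMCharIdentityClausesTest.nonsplit (hCM : CMCharIdentityClausesTest L H hH hHd Δ mH mG νH νG ξ μω hμu ξloc)
    (v : HeightOneSpectrum (𝓞 ↥(maximalRealSubfield L))) (hns : ∀ w : PlacesOver L v, IsCMField.complexConj L • w.1 = w.1)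
    (T : GL (Fin 3) (LocalRing L v)) (a : LocalRing L v) (ha : IsUnit a)
    (h : formCongr (conjLocal L (IsCMField.complexConj L) v) T (H.map (algebraMap L (LocalRing L v))) =
      a • (Matrix.of fun i j : Fin 3 => if i.val + j.val + 1 = 3 then (1 : L) else 0).map (algebraMap L (LocalRing L v)))
    [MeasurableSpace (Gqs L v ⧸ Subgroup.center (Gqs L v))] [BorelSpace (Gqs L v ⧸ Subgroup.center (Gqs L v))]
    (μZ : Measure (Gqs L v ⧸ Subgroup.center (Gqs L v))) [μZ.IsHaarMeasure] (π2 πn : IrrClass (Gqs L v))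
    (hK : KeysCaseTwoLabels L v (μω.semilocalComponent L v) (torusLocalComponent L (IsCMField.complexConj L) v ξ.η)
      (torusLocalComponent L (IsCMField.complexConj L) v ξ.ψ) π2 πn)
    (hn : ¬ πn.IsSquareIntegrable μZ) :
    CMNonsplitCharIdentityAtTest L v H (Δ v) (mH v) (mG v) (νG v) (νH v) (ξloc v) (IrrClass.comap (cmDatumLocalCongr L v T ha h).symm πn) :=
  hCM.1 v hns T a ha h μZ π2 πn hK hn

/-- **Read-back at a SPLIT place**: the identity on test functions for the singleton packet `{i_G(ξ_v ⊗ μ_w ∘ det₀)}` at the fixed witness `w = splitWitness v hs`.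
[cite: Rogawski1990, §4.13 Lemma 4.13.1 (b) p. 63; §13.1 Prop. 13.1.4 p. 199; §13.3 p. 201] -/
theorem CMCharIdentityClausesTest.split (hCM : CMCharIdentityClausesTest L H hH hHd Δ mH mG νH νG ξ μω hμu ξloc)
    (v : HeightOneSpectrum (𝓞 ↥(maximalRealSubfield L))) (hs : ∃ w : PlacesOver L v, IsCMField.complexConj L • w.1 ≠ w.1) :
    CMSplitCharIdentityAtTest L v H hH hHd (splitWitness v hs) (splitWitness_spec v hs) (ξ.splitν₀ μω (splitWitness v hs).1)
      (ξ.locψ (splitWitness v hs).1) (ξ.norm_splitν₀_apply hμu (splitWitness v hs).1)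
      (ξ.continuous_splitν₀ μω (splitWitness v hs).1) (ξ.norm_locψ_apply (splitWitness v hs).1)
      (ξ.continuous_locψ (splitWitness v hs).1) (Δ v) (mH v) (mG v) (νG v) (νH v) (ξloc v) :=
  hCM.2 v hs

/-- **OLD ⇒ NEW**: ★ `CMCharIdentityClauses` gives `CMCharIdentityClausesTest`. [cite: Rogawski1990, §13.1 Prop. 13.1.4 p. 199; §4.13 Lemma 4.13.1 (b) p. 63] -/
theorem CMCharIdentityClauses.test (hCM : CMCharIdentityClauses L H hH hHd Δ mH mG νH νG ξ μω hμu ξloc) :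
    CMCharIdentityClausesTest L H hH hHd Δ mH mG νH νG ξ μω hμu ξloc :=
  ⟨fun v hns T a ha h _ _ μZ _ π2 πn hK hn => (hCM.nonsplit v hns T a ha h μZ π2 πn hK hn).test L v H, fun v hs => (hCM.split v hs).test L v H hH hHd⟩

/-- **Read-back of the test package at a character `ξ`.** [cite: Rogawski1990, §13.1 Prop. 13.1.4 p. 199; §13.3 p. 202] -/
theorem CMCharIdentityPackageTest.clauses (hQ : CMCharIdentityPackageTest L H hH hHd νH νG μω hμu Δ mH mG) (ξ : OneDimAutRepH L) :
    CMCharIdentityClausesTest L H hH hHd Δ mH mG νH νG ξ μω hμu (fun v => ξ.xiLocalChar v) :=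
  hQ ξ

/-- **Read-back of the test package at a NON-SPLIT place** — the consumer's `sFin₀ ξ v := (hQ.nonsplit ξ v hns T a ha h μZ π2 πn hK hn).πs` after repair R3∕R4
(`CMNonsplitCharIdentityAtTest.πs`, `….charIdentityAtTest_πs`). [cite: Rogawski1990, §13.1 Prop. 13.1.3 (d), Prop. 13.1.4 p. 199; §12.2 p. 174; §13.3 p. 202] -/
theorem CMCharIdentityPackageTest.nonsplit (hQ : CMCharIdentityPackageTest L H hH hHd νH νG μω hμu Δ mH mG) (ξ : OneDimAutRepH L)
    (v : HeightOneSpectrum (𝓞 ↥(maximalRealSubfield L))) (hns : ∀ w : PlacesOver L v, IsCMField.complexConj L • w.1 = w.1)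
    (T : GL (Fin 3) (LocalRing L v)) (a : LocalRing L v) (ha : IsUnit a)
    (h : formCongr (conjLocal L (IsCMField.complexConj L) v) T (H.map (algebraMap L (LocalRing L v))) =
      a • (Matrix.of fun i j : Fin 3 => if i.val + j.val + 1 = 3 then (1 : L) else 0).map (algebraMap L (LocalRing L v)))
    [MeasurableSpace (Gqs L v ⧸ Subgroup.center (Gqs L v))] [BorelSpace (Gqs L v ⧸ Subgroup.center (Gqs L v))]
    (μZ : Measure (Gqs L v ⧸ Subgroup.center (Gqs L v))) [μZ.IsHaarMeasure] (π2 πn : IrrClass (Gqs L v))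
    (hK : KeysCaseTwoLabels L v (μω.semilocalComponent L v) (torusLocalComponent L (IsCMField.complexConj L) v ξ.η)
      (torusLocalComponent L (IsCMField.complexConj L) v ξ.ψ) π2 πn)
    (hn : ¬ πn.IsSquareIntegrable μZ) :
    CMNonsplitCharIdentityAtTest L v H (Δ v) (mH v) (mG v) (νG v) (νH v) (ξ.xiLocalChar v)
      (IrrClass.comap (cmDatumLocalCongr L v T ha h).symm πn) :=
  (hQ ξ).nonsplit v hns T a ha h μZ π2 πn hK hn

/-- **Read-back of the test package at a SPLIT place.** [cite: Rogawski1990, §4.13 Lemma 4.13.1 (b) p. 63; §13.1 Prop. 13.1.4 p. 199; §13.3 pp. 201–202] -/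
theorem CMCharIdentityPackageTest.split (hQ : CMCharIdentityPackageTest L H hH hHd νH νG μω hμu Δ mH mG) (ξ : OneDimAutRepH L)
    (v : HeightOneSpectrum (𝓞 ↥(maximalRealSubfield L))) (hs : ∃ w : PlacesOver L v, IsCMField.complexConj L • w.1 ≠ w.1) :
    CMSplitCharIdentityAtTest L v H hH hHd (splitWitness v hs) (splitWitness_spec v hs) (ξ.splitν₀ μω (splitWitness v hs).1)
      (ξ.locψ (splitWitness v hs).1) (ξ.norm_splitν₀_apply hμu (splitWitness v hs).1)
      (ξ.continuous_splitν₀ μω (splitWitness v hs).1) (ξ.norm_locψ_apply (splitWitness v hs).1)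
      (ξ.continuous_locψ (splitWitness v hs).1) (Δ v) (mH v) (mG v) (νG v) (νH v) (ξ.xiLocalChar v) :=
  (hQ ξ).split v hs

/-- **OLD ⇒ NEW**: ★ `CMCharIdentityPackage` gives `CMCharIdentityPackageTest` (so every export of the old `Q_CM` re-types for free).
[cite: Rogawski1990, §13.1 Prop. 13.1.4 p. 199; §13.3 p. 202] -/
theorem CMCharIdentityPackage.test (hQ : CMCharIdentityPackage L H hH hHd νH νG μω hμu Δ mH mG) :
    CMCharIdentityPackageTest L H hH hHd νH νG μω hμu Δ mH mG :=
  fun ξ => (hQ.clauses ξ).test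

end Clauses

end Literature.NumberTheory.Rogawski1990

end
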